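import Summits.NavierStokesRegularity.NavierStokesRegularity.Theorems.PerpetualPumpAveragedTypeIBlowupHandoffSlow
import Summits.NavierStokesRegularity.NavierStokesRegularity.Theorems.PerpetualPumpAveragedTypeIBlowupHandoffPulse
import Summits.NavierStokesRegularity.NavierStokesRegularity.Theorems.PerpetualPumpAveragedTypeIBlowupHandoffInv
import Summits.NavierStokesRegularity.NavierStokesRegularity.Theorems.PerpetualPumpAveragedTypeIBlowupOneStepCoreTube

/-!
# Crux `PerpetualPump.AveragedTypeIBlowup` (stmt-NavierStokesRegularity-1835), line `Sketch`:
# the registered stub `stub_handoff` — THE HAND-OFF of the window one-step theorem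

In the pinned context of the window one-step theorem (`stub_oneStep`): the regime, the critical Toda
system with memory errors on `[0, T]` in `C¹` form, the far tail above the front `n`, the hand-off
invariant `Inv n B t₀`, the first ignition data of the front bond at `t_ι`, the pre-ignition box `Pre`
on `[t₀, t_ι]` and the pulse box `Pul` on the full pulse horizon `[t_ι, t_ι + σ_P/R_n] ⊆ [0, T]`
(`σ_P = (5 log b_n(t_ι) + 20)/b_n(t_ι)`), the theorem `stub_handoff` produces the first branch of
`stub_oneStep`: a hand-off time `t₁ ∈ (t₀, T)`, `t₁ ≤ t₀ + 4/R_n`, a new level `B'` with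
`Inv (n+1) B' t₁`, the growth bounds `q(B + log ε̄ − 6 log(B+2) − 58) ≤ B' ≤ q(B + log(10(F+2)ε̄B) + 25)`,
the tube on `[t₀, t₁]` and the strict first crossing of level `1` by `b_{n+1}`.

Proof. In the slow time `σ = R_n(t − t_ι)` the front triple `(b_n, w_n, b_{n+1}/q)` is a forced Toda
gate with forcing `≤ 1/2000` (`handoff_frontPkg`, `handoff_forcing`, the pulse box) and the next bond
a slaved linear mode (`handoff_nextPkg`); the transfer pulse read at the argmax time `σ_e` of the next
carrier (`handoff_pulseFacts`) gives `t₁ = t_ι + σ_e/R_n`, `B' = b_{n+1}(t₁)`; then `handoff_growth`,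
`handoff_levelOne_numeric`, `handoff_inv`, `oneStepCore_tube_of_pre/_pul`, `handoff_crossing` (`w_n ≥ 9`
at the passage time by `handoff_w_lower`, and the `C¹` form of the system).

## References

T. Tao, *Finite time blowup for an averaged three-dimensional Navier–Stokes equation*, J. Amer.
Math. Soc. 29 (2016), §5–6 (the cascade / transfer heuristics); folklore ODE bookkeeping here.
-/

noncomputable section

-- the summit namespace `…NavierStokesRegularity.NavierStokesRegularity…` is the tree convention
set_option linter.dupNamespace false

open Set MeasureTheory Filter Topology intervalIntegral

namespace Summit.NavierStokesRegularity.NavierStokesRegularity.Theorems.PerpetualPumpAveragedTypeIBlowup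

/-- **Rates and clock algebra**: `R_{n+1}/R_n = q⁴` (`q = √(1+ε₀)`, `R_k = D(1+ε₀)^{2k} > 0`),
`t_b + R(s − t_b)/R = s`, `R((t_b + σ/R) − t_b) = σ`. [folklore] -/
theorem handoff_rates {ε₀ D q : ℝ} {R : ℤ → ℝ} (hε₀ : 0 < ε₀) (hD : 0 < D)
    (hR : ∀ k : ℤ, R k = D * (1 + ε₀) ^ (2 * k)) (hq4 : q ^ 4 = (1 + ε₀) ^ 2) (n : ℤ) :
    (∀ k : ℤ, 0 < R k) ∧ R (n + 1) / R n = q ^ 4 ∧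
    (∀ tb s : ℝ, tb + R n * (s - tb) / R n = s) ∧ (∀ tb σ : ℝ, R n * ((tb + σ / R n) - tb) = σ) := by
  have ha : (0 : ℝ) < 1 + ε₀ := by linarith
  have hpos : ∀ k : ℤ, 0 < R k := fun k => by rw [hR]; exact mul_pos hD (zpow_pos ha _)
  have hn0 : R n ≠ 0 := (hpos n).ne'
  have h1 : R (n + 1) = R n * (1 + ε₀) ^ 2 := by
    rw [hR, hR, show 2 * (n + 1) = 2 * n + 2 by ring, zpow_add₀ ha.ne', zpow_two]
    ring
  refine ⟨hpos, ?_, fun tb s => ?_, fun tb σ => ?_⟩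
  · rw [h1, hq4]; field_simp
  · field_simp; ring
  · field_simp; ring

/-- **Registered stub `stub_handoff`** (line `Sketch`, crux stmt-NavierStokesRegularity-1835): THE
HAND-OFF of the window one-step theorem — see the module docstring. [folklore] -/
theorem stub_handoff :
    ∀ (ε₀ D εb θ η F blo bhi : ℝ) (n₀ : ℤ) (bv wv M0 M1 db dw : ℤ → ℝ → ℝ) (q : ℝ) (R : ℤ → ℝ) (lad : ℕ → ℝ)
      (G0 G1 : ℤ → ℝ → ℝ) (Inv : ℤ → ℝ → ℝ → Prop) (Tube : ℤ → ℝ → Prop) (n : ℤ) (B t₀ T : ℝ),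
      q = Real.sqrt (1 + ε₀) → (∀ k : ℤ, R k = D * (1 + ε₀) ^ (2 * k)) →
      (∀ j : ℕ, lad j = εb * ((1 + ε₀) ^ (19 * (j - 2)))⁻¹) →
      (∀ (k : ℤ) (t : ℝ), G0 k t = (wv (k - 1) t) ^ 2 / q ^ 3 - (wv k t) ^ 2 - εb * bv k t * wv k t) →
      (∀ (k : ℤ) (t : ℝ), G1 k t = wv k t * (bv k t - bv (k + 1) t / q) + εb * (bv k t) ^ 2) →
      (∀ (m : ℤ) (Bm t : ℝ), Inv m Bm t ↔
        (bv m t = Bm ∧ (∀ s ∈ Icc 0 t, bv m s ≤ Bm) ∧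
        (0 ≤ wv m t ∧ wv m t ≤ F * εb * Bm ∧ M1 m t ≤ F * εb * Bm ∧ M0 m t ≤ 2 * Bm) ∧
        (n₀ ≤ m - 1 → 0 ≤ wv (m - 1) t ∧ q ^ 3 * Bm - 1 ≤ (wv (m - 1) t) ^ 2 ∧
          (wv (m - 1) t) ^ 2 ≤ q ^ 3 * Bm + 1 ∧ 9 / 20 ≤ bv (m - 1) t ∧ bv (m - 1) t ≤ 11 / 20 ∧
          M0 (m - 1) t ≤ 5 * (bhi + 4) ^ 2 ∧ M1 (m - 1) t ≤ 5 * (bhi + 4) ^ 2) ∧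
        (|bv (m + 1) t| ≤ εb ∧ |wv (m + 1) t| ≤ εb ∧ M0 (m + 1) t ≤ εb ∧ M1 (m + 1) t ≤ εb) ∧
        (∀ j : ℕ, 2 ≤ j → |bv (m + j) t| ≤ lad j ∧ |wv (m + j) t| ≤ lad j / 5 ∧
          M0 (m + j) t ≤ lad j ∧ M1 (m + j) t ≤ lad j) ∧
        (∀ j : ℕ, 1 ≤ j → ∀ s ∈ Icc 0 t, bv (m + j) s ≤ 1 / 2) ∧
        (∀ k : ℤ, n₀ ≤ k → k ≤ m - 2 → ∃ te ∈ Icc 0 t,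
          (-(2 / 5) ≤ bv k te ∧ bv k te ≤ 3 / 10 ∧ |wv k te| ≤ 1 / 200 ∧
            M0 k te ≤ 10 * (bhi + 4) ^ 2 ∧ M1 k te ≤ 10 * (bhi + 4) ^ 2) ∧
          ∀ s ∈ Icc te t, -(9 / 20) ≤ bv k s ∧ bv k s ≤ 7 / 20 ∧ |wv k s| ≤ 1 / 100 ∧
            M0 k s ≤ 10 * (bhi + 4) ^ 2 + 1 ∧ M1 k s ≤ 10 * (bhi + 4) ^ 2 + 1 ∧ |wv (k - 1) s| ≤ 1 / 100 ∧
            -(1 / 2) ≤ bv (k + 1) s ∧ bv (k + 1) s ≤ 9 / 10))) →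
      (∀ (m : ℤ) (t : ℝ), Tube m t ↔
        ((∀ k : ℤ, k ≤ m + 1 → |bv k t| ≤ 2 * (bhi + 3) ∧ |wv k t| ≤ 2 * (bhi + 3) ∧
          M0 k t ≤ 20 * (bhi + 4) ^ 2 ∧ M1 k t ≤ 20 * (bhi + 4) ^ 2) ∧
        (∀ j : ℕ, 2 ≤ j → |bv (m + j) t| ≤ lad j ∧ |wv (m + j) t| ≤ lad j ∧
          M0 (m + j) t ≤ lad j ∧ M1 (m + j) t ≤ lad j))) →
      -- regime
      0 < ε₀ → ε₀ ≤ 1 / 20 → 0 < D → 1 / 2 ≤ θ → θ ≤ 1 → 0 ≤ η → 0 < εb → εb ≤ 1 / 10 ^ 6 →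
      10 ^ 4 + 40 - 5 * Real.log εb ≤ blo → 10 ^ 9 * (bhi + 4) ^ 4 ≤ F →
      η * (10 ^ 9 * (bhi + 4) ^ 4 * (F + 1)) ≤ 1 → εb * (10 ^ 9 * (F + 1) ^ 2 * (bhi + 4) ^ 3) ≤ 1 →
      10 ^ 3 + 20 * Real.log (bhi + 5) + Real.log (F + 2) ≤ -Real.log εb →
      -- the critical system with memory errors on [0, T]
      n₀ ≤ n → 0 ≤ t₀ → t₀ < T → blo ≤ B → B ≤ bhi →
      (∀ k : ℤ, k < n₀ → ∀ t ∈ Icc 0 T, bv k t = 0 ∧ wv k t = 0 ∧ M0 k t = 0 ∧ M1 k t = 0) →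
      (∀ k : ℤ, ContinuousOn (bv k) (Icc 0 T) ∧ ContinuousOn (wv k) (Icc 0 T) ∧
        ContinuousOn (M0 k) (Icc 0 T) ∧ ContinuousOn (M1 k) (Icc 0 T)) →
      (∀ k : ℤ, ContinuousOn (db k) (Icc 0 T) ∧ ContinuousOn (dw k) (Icc 0 T) ∧
        ∀ t ∈ Ioo 0 T, HasDerivAt (bv k) (db k t) t ∧
          |db k t - R k * (-(bv k t) + G0 k t)| ≤ η * R k * M0 k t ∧
          HasDerivAt (wv k) (dw k t) t ∧ |dw k t - R k * (-(wv k t) + G1 k t)| ≤ η * R k * M1 k t) →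
      (∀ k : ℤ, ∀ t ∈ Icc 0 T, |bv k t| ≤ M0 k t ∧ |wv k t| ≤ M1 k t ∧ 0 ≤ M0 k t ∧ 0 ≤ M1 k t) →
      (∀ k : ℤ, ∀ t₁ ∈ Icc 0 T, ∀ t₂ ∈ Icc t₁ T,
        M0 k t₂ ≤ M0 k t₁ * Real.exp (-(θ * R k * (t₂ - t₁))) +
          R k * ∫ u in t₁..t₂, Real.exp (-(θ * R k * (t₂ - u))) * |G0 k u| ∧
        M1 k t₂ ≤ M1 k t₁ * Real.exp (-(θ * R k * (t₂ - t₁))) +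
          R k * ∫ u in t₁..t₂, Real.exp (-(θ * R k * (t₂ - u))) * |G1 k u|) →
      -- the a-priori far tail above the front, and the hand-off invariant at t₀
      (∃ J : ℕ, ∀ j : ℕ, J ≤ j → ∀ t ∈ Icc 0 T,
        |bv (n + j) t| ≤ lad j ∧ |wv (n + j) t| ≤ lad j / 5 ∧ M0 (n + j) t ≤ lad j ∧ M1 (n + j) t ≤ lad j) →
      Inv n B t₀ →
      ∀ (Pre Pul : ℝ → Prop) (tι : ℝ),
      (∀ s : ℝ, Pre s ↔
        ((B * Real.exp (-(R n * (s - t₀))) - 3 / 2 ≤ bv n s ∧ bv n s ≤ B * Real.exp (-(R n * (s - t₀))) + 5 / 2 ∧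
          0 ≤ wv n s ∧ M0 n s ≤ 6 * (B + 3) ∧
          M1 n s ≤ F * εb * B + 2 * wv n s + 2 * εb * (B + 3) ^ 2 * (R n * (s - t₀))) ∧
        (n₀ ≤ n - 1 → -(1 / 100) ≤ wv (n - 1) s ∧ (wv (n - 1) s) ^ 2 ≤ q ^ 3 * B + 2 ∧
          -(2 / 5) ≤ bv (n - 1) s ∧ bv (n - 1) s ≤ 17 / 20 ∧
          (t₀ + 2 * (100 + 4 * Real.log (bhi + 5)) / (B * R n) ≤ s → |wv (n - 1) s| ≤ 1 / 200 ∧ bv (n - 1) s ≤ 3 / 10) ∧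
          M0 (n - 1) s ≤ 6 * (bhi + 4) ^ 2 ∧ M1 (n - 1) s ≤ 6 * (bhi + 4) ^ 2 ∧
          (1 + ε₀) ^ (-(2 : ℤ)) * R n * ∫ u in t₀..s, (wv (n - 1) u) ^ 2 ≤ 9 / 10) ∧
        (|bv (n + 1) s| ≤ εb + q / 100 + 1 / 10 ^ 3 ∧ |wv (n + 1) s| ≤ 11 / 10 * εb ∧
          M0 (n + 1) s ≤ εb + (B + 3) / 40 ∧ M1 (n + 1) s ≤ 4 * εb) ∧
        (∀ j : ℕ, 2 ≤ j → |bv (n + j) s| ≤ lad j ∧ |wv (n + j) s| ≤ lad j / 5 ∧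
          M0 (n + j) s ≤ lad j ∧ M1 (n + j) s ≤ lad j) ∧
        (∀ k : ℤ, n₀ ≤ k → k ≤ n - 2 → -(9 / 20) ≤ bv k s ∧ bv k s ≤ 7 / 20 ∧ |wv k s| ≤ 1 / 100 ∧
          M0 k s ≤ 10 * (bhi + 4) ^ 2 + 1 ∧ M1 k s ≤ 10 * (bhi + 4) ^ 2 + 1))) →
      (∀ s : ℝ, Pul s ↔
        ((-(1 / 2) ≤ bv n s ∧ bv n s ≤ bv n tι + 1 / 100 ∧ |wv n s| ≤ bv n tι + 1 / 100 ∧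
          -(q / 50) ≤ bv (n + 1) s ∧ bv (n + 1) s ≤ q * (bv n tι + 1 / 100) ∧
          M0 n s ≤ 3 * (bhi + 4) ^ 2 ∧ M1 n s ≤ 5 * (bhi + 4) ^ 2 ∧ M0 (n + 1) s ≤ 3 / 2 * B ∧
          |wv (n + 1) s| ≤ 1 / 10 ^ 3 ∧ M1 (n + 1) s ≤ 1) ∧
        (n₀ ≤ n - 1 → |wv (n - 1) s| ≤ 1 / 200 ∧ -(2 / 5) ≤ bv (n - 1) s ∧ bv (n - 1) s ≤ 3 / 10 ∧
          M0 (n - 1) s ≤ 6 * (bhi + 4) ^ 2 ∧ M1 (n - 1) s ≤ 6 * (bhi + 4) ^ 2 ∧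
          (1 + ε₀) ^ (-(2 : ℤ)) * R n * ∫ u in t₀..s, (wv (n - 1) u) ^ 2 ≤ 9 / 10) ∧
        (∀ j : ℕ, 2 ≤ j → |bv (n + j) s| ≤ lad j ∧ |wv (n + j) s| ≤ lad j / 5 ∧
          M0 (n + j) s ≤ lad j ∧ M1 (n + j) s ≤ lad j) ∧
        (∀ k : ℤ, n₀ ≤ k → k ≤ n - 2 → -(9 / 20) ≤ bv k s ∧ bv k s ≤ 7 / 20 ∧ |wv k s| ≤ 1 / 100 ∧
          M0 k s ≤ 10 * (bhi + 4) ^ 2 + 1 ∧ M1 k s ≤ 10 * (bhi + 4) ^ 2 + 1))) →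
      t₀ < tι → tι ≤ t₀ + 3 / R n → t₀ + 2 * (100 + 4 * Real.log (bhi + 5)) / (B * R n) ≤ tι → 10 ^ 4 ≤ bv n tι →
      (∀ s ∈ Icc t₀ tι, Pre s) → (∀ s ∈ Ioc t₀ tι, 0 < wv n s) → (R n * ∫ u in t₀..tι, (wv n u) ^ 2 ≤ 1 / 100) →
      (∀ s ∈ Icc t₀ tι, (wv n s) ^ 2 ≤ bv n s / 100) → (wv n tι) ^ 2 = bv n tι / 100 →
      bv n tι ≤ B + Real.log (10 * (F + 2) * εb * B) + 6 * (R n * (tι - t₀) + 1) →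
      B * (1 - Real.exp (-(R n * (tι - t₀)))) ≤
        max 0 (Real.log (6 / 10 * Real.sqrt (B + 4) / (εb * B))) + 6 * (R n * (tι - t₀) + 1) + 2 →
      tι + (5 * Real.log (bv n tι) + 20) / bv n tι / R n ≤ T →
      (∀ s ∈ Icc tι (tι + (5 * Real.log (bv n tι) + 20) / bv n tι / R n), Pul s) →
      (∃ t₁ ∈ Ioo t₀ T, t₁ ≤ t₀ + 4 / R n ∧ ∃ B' : ℝ, Inv (n + 1) B' t₁ ∧
        q * (B + Real.log εb - 6 * Real.log (B + 2) - 58) ≤ B' ∧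
        B' ≤ q * (B + Real.log (10 * (F + 2) * εb * B) + 25) ∧
        (∀ t ∈ Icc t₀ t₁, Tube n t ∧ bv n t ≤ B + 3) ∧
        (∃ tc ∈ Ioo t₀ t₁, (∀ s ∈ Ico t₀ tc, bv (n + 1) s < 1) ∧ bv (n + 1) tc = 1 ∧
          ∃ δ : ℝ, 0 < δ ∧ tc + δ ≤ t₁ ∧ ∀ s ∈ Ioc tc (tc + δ), 1 < bv (n + 1) s)) := by
  intro ε₀ D εb θ η F blo bhi n₀ bv wv M0 M1 db dw q R lad G0 G1 Inv Tube n B t₀ T hq hR hlad hG0 hG1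
    hInv hTube hε₀ hε₀' hD hθ1 hθ2 hη hεb hεb6 hblo hF hηreg hεbreg _hseed hn₀ ht₀ ht₀T hBlo hBhi hvan
    hcont hC1 hmaj hrest _htail hInv0 Pre Pul tι hPre hPul htι0 htι3 _htιI hBp hPreAll hwpos _hIw hwb
    hign hnew2 hnew1 hTP hPulAll
  -- ### the regime
  obtain ⟨hεb1, hB4, -, hF0, hFεB, hεbhi2, hq1, hq2⟩ :=
    oneStepCore_regime hε₀ hε₀' hεb hεb6 hblo hF hεbreg hBlo hBhi hq
  have hbhi4 : 1 ≤ bhi + 4 := by linarith only [hB4, hBhi]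
  obtain ⟨hηhi, hεbhi, hηhi', hq0, -, hq4eq, -, hq4, -, hq3, -, -, -, hη3⟩ :=
    handoff_regime hε₀ hε₀' hη hεb hF hbhi4 hηreg hεbreg hq
  obtain ⟨hRpos, hRq, htime, htime'⟩ := handoff_rates hε₀ hD hR hq4eq n
  have hRn : 0 < R n := hRpos n
  have hlad' := handoff_lad hε₀.le hεb.le hlad
  -- ### the clocks
  obtain ⟨hclock3, hclock0, h34, -, -⟩ := oneStepCore_clock (t₀ := t₀) hRn
  obtain ⟨τ0, hτ0def⟩ : ∃ τ0 : ℝ, τ0 = R n * (tι - t₀) := ⟨_, rfl⟩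
  have hτ0 : 0 ≤ τ0 := by rw [hτ0def]; exact hclock0 tι htι0.le
  have hτ3 : τ0 ≤ 3 := by rw [hτ0def]; exact hclock3 tι htι3
  rw [← hτ0def] at hnew1 hnew2
  have htι : 0 < tι := lt_of_le_of_lt ht₀ htι0
  -- the pre-ignition box at the ignition time
  obtain ⟨⟨hbloι, hbhiι, -, -, -⟩, -, ⟨hx1ι, hy1ι, -, hMy1ι⟩, -, -⟩ := (hPre tι).1 (hPreAll tι ⟨htι0.le, le_rfl⟩)
  rw [← hτ0def] at hbloι hbhiι
  have hBp52 : bv n tι ≤ B + 5 / 2 := by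
    have := oneStepCore_mul_exp_neg_le (by linarith only [hB4] : (0:ℝ) ≤ B) hτ0
    linarith only [this, hbhiι]
  have hBp0 : 0 ≤ bv n tι := by linarith only [hBp]
  -- the pulse horizon
  obtain ⟨σP, hσP⟩ : ∃ σP : ℝ, σP = (5 * Real.log (bv n tι) + 20) / bv n tι := ⟨_, rfl⟩
  obtain ⟨hσP10, hσP0, hσP1, hBσP, -, -⟩ := handoff_sigmaP_le hBp
  rw [← hσP] at hσP10 hσP0 hσP1 hBσP
  have hTP' : tι + σP / R n ≤ T := by rw [hσP]; exact hTP
  have hPulP : ∀ s ∈ Icc tι (tι + σP / R n), Pul s := by rw [hσP]; exact hPulAll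
  have hT0 : 0 < T := lt_of_le_of_lt ht₀ ht₀T
  have hτmem : ∀ σ ∈ Icc 0 σP, tι + σ / R n ∈ Icc tι (tι + σP / R n) ∧ tι + σ / R n ∈ Icc 0 T := by
    intro σ hσ
    have h0 : 0 ≤ σ / R n := div_nonneg hσ.1 hRn.le
    have h1 : σ / R n ≤ σP / R n := div_le_div_of_nonneg_right hσ.2 hRn.le
    exact ⟨⟨by linarith only [h0], by linarith only [h1]⟩, by linarith only [htι, h0],
      by linarith only [h1, hTP']⟩
  -- ### the slow-time objects
  obtain ⟨b, hb⟩ : ∃ b : ℝ → ℝ, b = fun σ => bv n (tι + σ / R n) := ⟨_, rfl⟩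
  obtain ⟨w, hw⟩ : ∃ w : ℝ → ℝ, w = fun σ => wv n (tι + σ / R n) := ⟨_, rfl⟩
  obtain ⟨β, hβ⟩ : ∃ β : ℝ → ℝ, β = fun σ => bv (n + 1) (tι + σ / R n) / q := ⟨_, rfl⟩
  obtain ⟨f₁, hf₁⟩ : ∃ f₁ : ℝ → ℝ, f₁ = fun σ => G0 n (tι + σ / R n) + (wv n (tι + σ / R n)) ^ 2 +
      (db n (tι + σ / R n) - R n * (-(bv n (tι + σ / R n)) + G0 n (tι + σ / R n))) / R n := ⟨_, rfl⟩
  obtain ⟨f₂, hf₂⟩ : ∃ f₂ : ℝ → ℝ, f₂ = fun σ => G1 n (tι + σ / R n) -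
      wv n (tι + σ / R n) * (bv n (tι + σ / R n) - bv (n + 1) (tι + σ / R n) / q) +
      (dw n (tι + σ / R n) - R n * (-(wv n (tι + σ / R n)) + G1 n (tι + σ / R n))) / R n := ⟨_, rfl⟩
  obtain ⟨f₃, hf₃⟩ : ∃ f₃ : ℝ → ℝ, f₃ = fun σ => q ^ 3 * G0 (n + 1) (tι + σ / R n) -
      (wv n (tι + σ / R n)) ^ 2 + (db (n + 1) (tι + σ / R n) -
        R (n + 1) * (-(bv (n + 1) (tι + σ / R n)) + G0 (n + 1) (tι + σ / R n))) / R n / q := ⟨_, rfl⟩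
  obtain ⟨y, hy⟩ : ∃ y : ℝ → ℝ, y = fun σ => wv (n + 1) (tι + σ / R n) := ⟨_, rfl⟩
  obtain ⟨my, hmy⟩ : ∃ my : ℝ → ℝ, my = fun σ => M1 (n + 1) (tι + σ / R n) := ⟨_, rfl⟩
  obtain ⟨x2, hx2⟩ : ∃ x2 : ℝ → ℝ, x2 = fun σ => bv (n + 2) (tι + σ / R n) := ⟨_, rfl⟩
  obtain ⟨ey, hey⟩ : ∃ ey : ℝ → ℝ, ey = fun σ => (dw (n + 1) (tι + σ / R n) -
      R (n + 1) * (-(wv (n + 1) (tι + σ / R n)) + G1 (n + 1) (tι + σ / R n))) / R n := ⟨_, rfl⟩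
  obtain ⟨hbc, hwc, hβc, hf1c, hf2c, hf3c, hbd, hwd, hβd, hres, hval⟩ :=
    handoff_frontPkg hG0 hG1 hcont hC1 hmaj hrest hRn hT0 htι.le hσP0.le hTP' hq0 hRq hb hw hβ hf₁ hf₂ hf₃
  obtain ⟨hyc, hmyc, hx2c, heyc, hyd, heyb, hmyr, hval2⟩ :=
    handoff_nextPkg hG0 hG1 hcont hC1 hmaj hrest hRn hT0 htι.le hσP0.le hTP' hq0 hRq hβ hy hmy hx2 hey
  -- the pulse box in slow time and the forcing bounds
  have hforce : ∀ σ ∈ Icc 0 σP, |f₁ σ| ≤ 1 / 2000 ∧ |f₂ σ| ≤ 1 / 2000 ∧ |f₃ σ| ≤ 1 / 2000 := by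
    intro σ hσ
    obtain ⟨hmem, hmemT⟩ := hτmem σ hσ
    obtain ⟨⟨hbnlo, hbnhi, hwn, hxlo, hxhi, hM0n, hM1n, hM0x, hy3, -⟩, hprev, -, -⟩ :=
      (hPul _).1 (hPulP _ hmem)
    obtain ⟨hr1, hr2, hr3⟩ := hres σ hσ
    have hwl : |wv (n - 1) (tι + σ / R n)| ≤ 1 / 200 := by
      rcases lt_or_ge (n - 1) n₀ with hlt | hge
      · rw [(hvan (n - 1) hlt _ hmemT).2.1, abs_zero]; norm_num
      · exact (hprev hge).1
    refine handoff_forcing hq1 hq2 hεb hη hεbhi hηhi hηhi' hbhi4 hwl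
      (abs_le.2 ⟨by linarith only [hbnlo, hbhi4], by linarith only [hbnhi, hBp52, hBhi]⟩)
      (hwn.trans (by linarith only [hBp52, hBhi])) (abs_le.2 ⟨by linarith only [hxlo, hq2, hbhi4], ?_⟩)
      hy3 hM0n hM1n (by linarith only [hM0x, hBhi, hB4]) hr1 hr2 hr3
    have : q * (bv n tι + 1 / 100) ≤ 21 / 20 * (bhi + 3) :=
      mul_le_mul hq2 (by linarith only [hBp52, hBhi]) (by linarith only [hBp0]) (by norm_num)
    linarith only [hxhi, this, hbhi4]
  -- the initial data of the gate
  have hb0 : b 0 = bv n tι := by rw [(hval 0).1, zero_div, add_zero]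
  have hw0 : w 0 = Real.sqrt (bv n tι) / 10 := by
    rw [(hval 0).2.1, zero_div, add_zero]
    have hpos := hwpos tι ⟨htι0, le_rfl⟩
    rw [← Real.sqrt_sq hpos.le, hign, Real.sqrt_div hBp0,
      show (100 : ℝ) = 10 ^ 2 by norm_num, Real.sqrt_sq (by norm_num)]
  have hβ0 : |β 0| ≤ 1 / 50 := by
    have h1 : β 0 = bv (n + 1) tι / q := by rw [hβ]; simp
    rw [h1, abs_div, abs_of_pos hq0, div_le_iff₀ hq0]
    linarith only [hx1ι, hεb6, hq1]
  -- the data of the next bond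
  have hx2b : ∀ σ ∈ Icc 0 σP, |x2 σ| ≤ 1 / 2 := by
    intro σ hσ
    obtain ⟨-, -, hl, -⟩ := (hPul _).1 (hPulP _ (hτmem σ hσ).1)
    rw [(hval2 σ).2.2, show n + 2 = n + ((2 : ℕ) : ℤ) by push_cast; ring]
    exact (hl 2 le_rfl).1.trans (by rw [hlad'.2.1]; linarith only [hεb6])
  have hy0 : |y 0| ≤ 11 / 10 * εb := by rw [(hval2 0).1, zero_div, add_zero]; exact hy1ι
  have hmy0 : my 0 ≤ 4 * εb := by rw [(hval2 0).2.1, zero_div, add_zero]; exact hMy1ι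
  have hPhi : bv n tι + 1 ≤ bhi + 4 := by linarith only [hBp52, hBhi]
  have hεbP : εb * q ^ 2 * (bv n tι + 1) ^ 2 ≤ 1 := by
    have hq2' : q ^ 2 ≤ 2 := (pow_le_pow_left₀ hq0.le hq2 2).trans (by norm_num)
    have h1 : (bv n tι + 1) ^ 2 ≤ (bhi + 4) ^ 2 := pow_le_pow_left₀ (by linarith only [hBp0]) hPhi 2
    have h2 : εb * q ^ 2 * (bv n tι + 1) ^ 2 ≤ εb * 2 * (bhi + 4) ^ 2 :=
      mul_le_mul (mul_le_mul_of_nonneg_left hq2' hεb.le) h1 (by positivity) (by positivity)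
    linarith only [h2, hεbhi]
  have hηP : η * (q * (bv n tι + 1) + 1) ^ 3 ≤ 1 / 10 ^ 6 := by
    have h1 : q * (bv n tι + 1) + 1 ≤ 2 * (bhi + 4) := by
      have := mul_le_mul hq2 hPhi (by linarith only [hBp0]) (by norm_num)
      linarith only [this, hB4, hBhi]
    have h2 : (q * (bv n tι + 1) + 1) ^ 3 ≤ (2 * (bhi + 4)) ^ 3 :=
      pow_le_pow_left₀ (by positivity) h1 3
    have h3 := mul_le_mul_of_nonneg_left h2 hη
    have h4 : η * (2 * (bhi + 4)) ^ 3 = 8 * (η * (bhi + 4) ^ 3) := by ring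
    linarith only [h3, h4, hη3]
  -- ### the transfer pulse at the argmax time of the next carrier
  obtain ⟨σe, hσe, hmax, hβlo, hβhi, hwsq, hbhalf, hw1, -, henv, hypos, hyabs, hmyle, -, -⟩ :=
    handoff_pulseFacts b w β f₁ f₂ f₃ y my x2 ey (bv n tι) q θ η εb σP hBp hq1 hq2 hq4 hθ1 hθ2 hη hεb
      hεbP hηP hσP hbc hwc hβc hf1c hf2c hf3c hbd hwd hβd hforce hb0 hw0 hβ0 hyc hmyc hx2c heyc hyd heyb
      hmyr hx2b hy0 hmy0
  -- ### the hand-off time and the new level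
  obtain ⟨t₁, ht₁⟩ : ∃ t₁ : ℝ, t₁ = tι + σe / R n := ⟨_, rfl⟩
  obtain ⟨B', hB'⟩ : ∃ B' : ℝ, B' = bv (n + 1) t₁ := ⟨_, rfl⟩
  have hσeR : 0 < σe / R n := div_pos hσe.1 hRn
  have hσeR' : σe / R n < σP / R n := div_lt_div_of_pos_right hσe.2 hRn
  have hσPR : σP / R n ≤ 1 / R n := div_le_div_of_nonneg_right hσP1 hRn.le
  have hι1 : tι < t₁ := by rw [ht₁]; linarith only [hσeR]
  have ht₁P : t₁ < tι + σP / R n := by rw [ht₁]; linarith only [hσeR']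
  have ht₁T : t₁ < T := ht₁P.trans_le hTP'
  have ht₁4 : t₁ ≤ t₀ + 4 / R n := by rw [← h34, ht₁]; linarith only [htι3, hσeR', hσPR]
  have hB'q : B' = q * β σe := by rw [hB', ht₁, (hval σe).2.2]
  obtain ⟨hlow, hupp, hM0x2, h98, -, -, hB'1, -, -⟩ := handoff_growth hεb hεb1 (hblo.trans hBlo) hτ0 hτ3
    hnew1 hbloι hbhiι hnew2 hBp hβlo hβhi hq1 hB'q
  obtain ⟨hY1, hY2⟩ := handoff_levelOne_numeric hBp hq1 hq2 hεb hσe.1.le (by rw [← hσP]; exact hσe.2.le)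
    hF hPhi h98 rfl
  -- real time ↔ slow time on [tι, t₁]
  have hPul1 : ∀ s ∈ Icc tι t₁, Pul s := fun s hs => hPulP s ⟨hs.1, hs.2.trans ht₁P.le⟩
  have hσe1 : R n * (t₁ - tι) = σe := by rw [ht₁]; field_simp; ring
  have hslow : ∀ s ∈ Icc tι t₁, R n * (s - tι) ∈ Icc 0 σe ∧ tι + R n * (s - tι) / R n = s := by
    intro s hs
    have h3 : R n * (s - tι) ≤ R n * (t₁ - tι) :=
      mul_le_mul_of_nonneg_left (by linarith only [hs.2]) hRn.le
    exact ⟨⟨mul_nonneg hRn.le (by linarith only [hs.1]), by linarith only [h3, hσe1]⟩, htime tι s⟩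
  have hβmax : ∀ s ∈ Icc tι t₁, bv (n + 1) s ≤ B' := by
    intro s hs
    obtain ⟨hσs, hs'⟩ := hslow s hs
    have h1 := hmax _ ⟨hσs.1, hσs.2.trans hσe.2.le⟩
    have h2 := (hval (R n * (s - tι))).2.2
    rw [hs'] at h2
    rw [← h2, hB'q]
    exact mul_le_mul_of_nonneg_left h1 hq0.le
  -- the facts at t₁
  have hwn : w σe = wv n t₁ := by rw [(hval σe).2.1, ht₁]
  have hbn : b σe = bv n t₁ := by rw [(hval σe).1, ht₁]
  have hyn : y σe = wv (n + 1) t₁ := by rw [(hval2 σe).1, ht₁]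
  have hmyn : my σe = M1 (n + 1) t₁ := by rw [(hval2 σe).2.1, ht₁]
  have hq3B : q ^ 3 * B' = q ^ 4 * β σe := by rw [hB'q]; ring
  obtain ⟨hws1, hws2⟩ := abs_le.1 hwsq
  obtain ⟨hbh1, hbh2⟩ := abs_le.1 hbhalf
  have hInv1 : Inv (n + 1) B' t₁ :=
    handoff_inv hInv hPre hPul hlad' hεb.le (hεb6.trans (by norm_num)) hq2 ht₀ htι0.le hι1.le ht₁T.le hvan
      hInv0 hPreAll hPul1 hB'1.le hB'.symm hβmax (by rw [← hyn]; exact hypos.le)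
      (by rw [← hyn]; exact (le_abs_self _).trans (hyabs.trans hY1)) (by rw [← hmyn]; exact hmyle.trans hY2)
      hM0x2 (by rw [← hwn]; linarith only [hw1 σe ⟨hσe.1.le, le_rfl⟩])
      (by rw [← hwn, hq3B]; linarith only [hws1]) (by rw [← hwn, hq3B]; linarith only [hws2])
      (by rw [← hbn]; linarith only [hbh1]) (by rw [← hbn]; linarith only [hbh2])
  -- ### the tube on [t₀, t₁]
  have htube : ∀ t ∈ Icc t₀ t₁, Tube n t ∧ bv n t ≤ B + 3 := by
    intro t ht
    have htT : t ∈ Icc 0 T := ⟨ht₀.trans ht.1, ht.2.trans ht₁T.le⟩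
    have hlad0 : ∀ j : ℕ, 0 ≤ lad j := fun j => (hlad'.1 j).1
    rcases le_total t tι with h | h
    · exact oneStepCore_tube_of_pre ε₀ εb F bhi B n₀ n bv wv M0 M1 q R lad Tube t₀ t hTube hεb hεb1 hF0
        hFεB hεbhi2 hq1 hq2 hB4 hBhi hlad0 hn₀ (fun k hk => hvan k hk t htT) (hclock0 t ht.1)
        (hclock3 t (h.trans htι3)) (hwb t ⟨ht.1, h⟩) ((hPre t).1 (hPreAll t ⟨ht.1, h⟩))
    · exact oneStepCore_tube_of_pul ε₀ εb F bhi B n₀ n bv wv M0 M1 q R lad Tube t₀ t tι hTube hεb hεb1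
        hF0 hFεB hεbhi2 hq1 hq2 hB4 hBhi hlad0 hn₀ (fun k hk => hvan k hk t htT) hBp0 hBp52
        ((hPul t).1 (hPul1 t ⟨h, ht.2⟩))
  -- ### the strict first crossing of level 1 by the next carrier
  have hpre1 : ∀ s ∈ Icc t₀ tι, bv (n + 1) s < 1 := by
    intro s hs
    obtain ⟨-, -, ⟨h1, -⟩, -⟩ := (hPre s).1 (hPreAll s hs)
    have := le_abs_self (bv (n + 1) s)
    linarith only [h1, this, hεb6, hq2]
  have hposH : ∀ tc ∈ Ioo tι t₁, bv (n + 1) tc = 1 → (∀ s ∈ Ico tι tc, bv (n + 1) s < 1) →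
      0 < db (n + 1) tc := by
    intro tc htc hgc hbef
    obtain ⟨hσc, htc'⟩ := hslow tc ⟨htc.1.le, htc.2.le⟩
    have hσc0 : 0 < R n * (tc - tι) := mul_pos hRn (by linarith only [htc.1])
    have hσcP : R n * (tc - tι) ≤ σP := hσc.2.trans hσe.2.le
    -- the old bond at the crossing
    have hw9 : 9 ≤ w (R n * (tc - tι)) := by
      refine handoff_w_lower hBp hBσP hσP10 ⟨hσc0, hσcP⟩ hwc hwd (fun σ hσ => (hforce σ hσ).2.1) henv
        (fun σ hσ => hw1 σ ⟨hσ.1, hσ.2.trans hσc.2⟩) (fun σ hσ => ?_) hw0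
      have hsR : σ / R n < tc - tι := by
        have h := div_lt_div_of_pos_right hσ.2 hRn
        rwa [mul_div_cancel_left₀ _ hRn.ne'] at h
      have hs : tι + σ / R n ∈ Ico tι tc :=
        ⟨le_add_of_nonneg_right (div_nonneg hσ.1 hRn.le), by linarith only [hsR]⟩
      have h1 := hbef _ hs
      rw [show β σ = bv (n + 1) (tι + σ / R n) / q by rw [hβ], div_le_one hq0]
      linarith only [h1, hq1]
    rw [(hval _).2.1, htc'] at hw9
    -- the derivative of the next carrier at the crossing
    have htcT : tc ∈ Ioo 0 T := ⟨htι.trans htc.1, htc.2.trans ht₁T⟩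
    obtain ⟨-, hresid, -, -⟩ := (hC1 (n + 1)).2.2 tc htcT
    obtain ⟨⟨-, -, -, -, -, -, -, hM0x, hy3, -⟩, -, -, -⟩ := (hPul tc).1 (hPul1 tc ⟨htc.1.le, htc.2.le⟩)
    have hR1 : 0 < R (n + 1) := hRpos (n + 1)
    have hG : 65 ≤ -(bv (n + 1) tc) + G0 (n + 1) tc := by
      rw [hG0 (n + 1), show n + 1 - 1 = n by ring, hgc]
      have h1 : 67 ≤ (wv n tc) ^ 2 / q ^ 3 := by
        rw [le_div_iff₀ (by positivity)]; nlinarith only [hw9, hq3]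
      have h2 : (wv (n + 1) tc) ^ 2 ≤ 1 / 10 ^ 6 := by
        have h := pow_le_pow_left₀ (abs_nonneg _) hy3 2
        rw [sq_abs] at h
        linarith only [h]
      have h3 : εb * 1 * wv (n + 1) tc ≤ 1 / 1000 := by
        have h4 := mul_le_mul_of_nonneg_left (abs_le.1 hy3).2 hεb.le
        nlinarith only [h4, hεb6, hεb]
      linarith only [h1, h2, h3]
    have hM : η * R (n + 1) * M0 (n + 1) tc ≤ R (n + 1) * 1 := by
      have h1 : η * M0 (n + 1) tc ≤ 1 := by
        have h2 : η * M0 (n + 1) tc ≤ η * (3 / 2 * B) := mul_le_mul_of_nonneg_left hM0x hη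
        have h3 : η * B ≤ η * (bhi + 4) := mul_le_mul_of_nonneg_left (by linarith only [hBhi]) hη
        linarith only [h2, h3, hηhi']
      have h4 := mul_le_mul_of_nonneg_left h1 hR1.le
      have h5 : η * R (n + 1) * M0 (n + 1) tc = R (n + 1) * (η * M0 (n + 1) tc) := by ring
      linarith only [h4, h5]
    have h65 : R (n + 1) * 65 ≤ R (n + 1) * (-(bv (n + 1) tc) + G0 (n + 1) tc) :=
      mul_le_mul_of_nonneg_left hG hR1.le
    have h6 := (abs_le.1 hresid).1
    linarith only [h6, h65, hM, hR1]
  obtain ⟨tc, htc, hbelow, hgc, δ, hδ0, hδ1, habove⟩ := handoff_crossing ht₀ htι0 hι1 ht₁T (hcont (n + 1)).1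
    (hC1 (n + 1)).1 (fun t ht => ((hC1 (n + 1)).2.2 t ht).1) hpre1 (by rw [← hB']; exact hB'1) hposH
  -- ### assembly
  exact ⟨t₁, ⟨htι0.trans hι1, ht₁T⟩, ht₁4, B', hInv1, hlow, hupp, htube, tc, htc, hbelow, hgc, δ, hδ0, hδ1,
    habove⟩

/-- **Registered marker stub of this file** (`stub_handoffMarker`): the pulse horizon is positive and at
most a tenth of a slow unit. [folklore] -/
theorem stub_handoffMarker :
    ∀ x : ℝ, 10 ^ 4 ≤ x → (5 * Real.log x + 20) / x ≤ 1 / 10 ∧ 0 < (5 * Real.log x + 20) / x :=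
  fun _ hx => ⟨(handoff_sigmaP_le hx).1, (handoff_sigmaP_le hx).2.1⟩

end Summit.NavierStokesRegularity.NavierStokesRegularity.Theorems.PerpetualPumpAveragedTypeIBlowup

end
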